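import Summits.QuantumFields.BalabanUV.T4Continuum.Spine.NE2.OneStepRemainder
import Summits.QuantumFields.BalabanUV.T4Continuum.Support.NestedContourTransport

/-!
# T⁴ programme, spine node NE2 (U1a) — R14 W3c, file 1: THE STOKES LADDER FOR THE THIN LOOP OF [B7] (114) ON THE ONE-STEP CARRIERS — a bond, a leg, and the comb of
# `CovariantTableBalaban.contourFrom` swept `ℓ` steps along the averaging direction (cell `pub-balaban-gaps`, seat ne2 gen 6)

[B7] p. 25 bounds the holonomy of the contours of the one-step averaging by Prop. 1's axial-gauge ladder: «for `b ⊂ Δ(p′)` we have `|V_{0,b} − 1| < |b₋ − y|α₀ ≤ dLα₀` …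
`|V₀(Γ_{c,x}) − 1| ≤ Σ_{b⊂Γ_{c,x}} |V_{0,b} − 1| < |Γ_{c,x}|dLα₀ < (2d+1)LdLα₀ = O(1)L²α₀`» under (44) «`|V(∂p) − 1| < α₀`»; p. 36 then assumes «that `|Y_x| = O(L²α₀)` are
small», `Y_x = (1/i) log V₀(Γ_{c,x} ∪ (−c))` (114).  THIS FILE is the group-algebra half of that bound on the tree's one-step carriers (`CovariantBlockAveraging.transport`/`leg` in the
slot convention `transport R μ Γ = Π_{(x,ν)∈Γ} R ν (x, μ)`; the comb of `contourFrom` = the comb of `OneStepRemainder.Smain`, axis `0` first — DIVERGENCE D-ne2leaf07-1, immaterial), for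
CONTRACTIVE transporter data `V` and the COMMUTATOR-FORM plaquette letter `‖V_ν(x)V_μ(x+e_ν) − V_μ(x)V_ν(x+e_μ)‖ ≤ p` (for unitary data `= ‖V(∂p) − 1‖`, companion file):
 * the LADDER DEFECT **`lad`** `(P; z, x) = ‖T(P)·T(ℓ_x) − T(ℓ_z)·T(P + ℓe_μ)‖` (`ℓ_y` = the line of `ℓ` bonds from `y` along `μ`, `P + ℓe_μ` = `shiftBonds`), its COMPOSITION RULE
   **`lad_append_le`** `lad (P ++ Q; z, x) ≤ lad (P; z, y) + lad (Q; y, x)` (any `y`), the `1 × s` RECTANGLE **`rect_le`** (`≤ s·p`), one bond `lad_single_le` (`≤ ℓ·p`), a leg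
   **`lad_leg_le`** (`≤ s·ℓ·p`);
 * the comb of `contourFrom` as a `flatMap` of legs (**`comb`**, **`contourFrom_eq`** — `rfl`), its translate `shiftBonds_comb`, the induction over the axes (`combTake`, `natPrefix`, `psum`),
   and **`lad_comb_le`**: `‖T(Γ_{z,x})·T(ℓ_x) − T(ℓ_z)·T(Γ_{z⁺,x⁺})‖ ≤ (Σ_ν r_ν)·ℓ·p`, `x = z + r` — print's `|Γ_{c,x}|·(dL)α₀` with the comb length `Σ_ν r_ν` and the sweep `ℓ = L`.
Companion `OneStepLoopHolonomy`: the loop `V₀(Γ_{c,x} ∪ (−c))`, `‖loop − 1‖ ≤ (Σ_ν r_ν)·L·p`, the logarithms `Y_x`, `Y` with `‖·‖ ≤ 2dL²p`, hermiticity.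
HONEST FRAMING (T4-DAG p. 1).  [folklore] normed-ring bookkeeping about the tree's MODEL transporters on a finite torus; `V` is DATA asserted by nobody; the plaquette letter is a HYPOTHESIS
SHAPE ((44)/(109) locate it); nothing of Bałaban's asserted; NOT NE2, NOT [B9] (3.16)/(3.26) as printed; **NE2 (U1a) NOT PROVED**; spine PROVED 0/9 unchanged; NOT continuum YM / infinite
volume / mass gap / Clay.  HONEST DEPENDENCY: continuum YM on T⁴ ⇐ BetaPertH ∧ nine spine estimates (0/9 proved); BetaPertH ⇐ (D1) ∧ (D4) ∧ CAP+tail.  No `sorry`.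
-/

noncomputable section

open scoped BigOperators ComplexConjugate Matrix Matrix.Norms.L2Operator

namespace Summit.QuantumFields.BalabanUV.T4Continuum.NE2.OneStepLoopLadder

open Literature.MathematicalPhysics.QuantumFieldTheory.Balaban1983to89.B5Prop11Plancherel (Tor fine unitVec)
open Literature.MathematicalPhysics.QuantumFieldTheory.Balaban1983to89.B5Block118 (tstep tstep_zero tstep_succ)
open Summit.QuantumFields.BalabanUV.T4Continuum.CovariantBlockAveraging (transport transport_append leg length_leg)
open Summit.QuantumFields.BalabanUV.T4Continuum.NE2.CovariantTableBalaban (contourFrom)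

variable {d : ℕ} (N : ℕ) [NeZero N] (M : Fin d → ℕ) [hM : ∀ μ, NeZero (M μ)] {m : Type*} [Fintype m] [DecidableEq m]

/-! ## §1 The ladder: sweeping a bond, a leg, and the comb by `ℓ` steps along `μ` -/

section Ladder

variable (V : Fin d → (Tor (fine N M) × Fin d → Matrix m m ℂ)) (μ : Fin d) (ℓ : ℕ)

/-- the translate of a bond list by `ℓ e_μ`. [folklore] -/
def shiftBonds (P : List (Tor (fine N M) × Fin d)) : List (Tor (fine N M) × Fin d) :=
  P.map fun b => (b.1 + tstep (fine N M) μ ℓ, b.2)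

omit [NeZero N] hM in
/-- translation distributes over concatenation. [folklore] -/
theorem shiftBonds_append (P Q : List (Tor (fine N M) × Fin d)) :
    shiftBonds N M μ ℓ (P ++ Q) = shiftBonds N M μ ℓ P ++ shiftBonds N M μ ℓ Q := List.map_append

omit [NeZero N] hM in
/-- the translate of a leg is the leg from the translated point. [folklore] -/
theorem shiftBonds_leg (ν : Fin d) (z : Tor (fine N M)) (s : ℕ) :
    shiftBonds N M μ ℓ (leg N M ν z s) = leg N M ν (z + tstep (fine N M) μ ℓ) s := by
  rw [shiftBonds, leg, leg, List.map_map]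
  refine List.map_congr_left fun r _ => ?_
  simp only [Function.comp_apply, add_right_comm]

/-- **THE LADDER DEFECT** of a bond list `P` read between the points `z` and `x`: `‖T(P)·T(ℓ_x) − T(ℓ_z)·T(P + ℓe_μ)‖`, `ℓ_y` = the line of `ℓ` bonds from `y` along `μ`. [folklore] -/
def lad (P : List (Tor (fine N M) × Fin d)) (z x : Tor (fine N M)) : ℝ :=
  ‖transport (fine N M) V μ P * transport (fine N M) V μ (leg N M μ x ℓ)
    - transport (fine N M) V μ (leg N M μ z ℓ) * transport (fine N M) V μ (shiftBonds N M μ ℓ P)‖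

omit [NeZero N] hM in
/-- transport along no bond is `1`. [folklore] -/
theorem transport_nil : transport (fine N M) V μ ([] : List (Tor (fine N M) × Fin d)) = 1 := by
  simp [transport]

omit [NeZero N] hM in
/-- transport along one bond is its bond variable. [folklore] -/
theorem transport_singleton (b : Tor (fine N M) × Fin d) : transport (fine N M) V μ [b] = V b.2 (b.1, μ) := by
  simp [transport]

omit [NeZero N] hM in
/-- `leg z 0 = []`. [folklore] -/
theorem leg_zero (ν : Fin d) (z : Tor (fine N M)) : leg N M ν z 0 = [] := by
  simp [leg]

omit [NeZero N] hM in
/-- `leg z (s+1) = leg z s ++ [(z + s e_ν, ν)]`. [folklore] -/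
theorem leg_succ (ν : Fin d) (z : Tor (fine N M)) (s : ℕ) : leg N M ν z (s + 1) = leg N M ν z s ++ [(z + tstep (fine N M) ν s, ν)] := by
  simp only [leg, List.range_succ, List.map_append, List.map_cons, List.map_nil]

omit [NeZero N] hM in
/-- the empty list has no ladder defect. [folklore] -/
theorem lad_nil (z : Tor (fine N M)) : lad N M V μ ℓ [] z z = 0 := by
  rw [lad, shiftBonds, List.map_nil, transport_nil, Matrix.one_mul, Matrix.mul_one, sub_self, norm_zero]

variable {V}

omit [NeZero N] hM in
/-- transports of contractive data are contractive. [folklore] -/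
theorem norm_transport_le_one' [Nonempty m] (hV : ∀ ν b, ‖V ν b‖ ≤ 1) (P : List (Tor (fine N M) × Fin d)) : ‖transport (fine N M) V μ P‖ ≤ 1 :=
  CovariantVectorChartModulus.norm_transport_le_one (fine N M) hV μ P

omit [NeZero N] hM in
/-- **COMPOSITION OF LADDERS**: `lad (P ++ Q; z, x) ≤ lad (P; z, y) + lad (Q; y, x)` for ANY intermediate point `y` (contractive data):
`T(P)T(Q)T(ℓ_x) − T(ℓ_z)T(P⁺)T(Q⁺) = T(P)·[T(Q)T(ℓ_x) − T(ℓ_y)T(Q⁺)] + [T(P)T(ℓ_y) − T(ℓ_z)T(P⁺)]·T(Q⁺)`. [folklore] -/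
theorem lad_append_le [Nonempty m] (hV : ∀ ν b, ‖V ν b‖ ≤ 1) (P Q : List (Tor (fine N M) × Fin d)) (z y x : Tor (fine N M)) :
    lad N M V μ ℓ (P ++ Q) z x ≤ lad N M V μ ℓ P z y + lad N M V μ ℓ Q y x := by
  rw [lad, lad, lad, shiftBonds_append, transport_append, transport_append]
  set TP := transport (fine N M) V μ P
  set TQ := transport (fine N M) V μ Q
  set Tx := transport (fine N M) V μ (leg N M μ x ℓ)
  set Ty := transport (fine N M) V μ (leg N M μ y ℓ)
  set Tz := transport (fine N M) V μ (leg N M μ z ℓ)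
  set TP' := transport (fine N M) V μ (shiftBonds N M μ ℓ P)
  set TQ' := transport (fine N M) V μ (shiftBonds N M μ ℓ Q)
  have e : TP * TQ * Tx - Tz * (TP' * TQ') = TP * (TQ * Tx - Ty * TQ') + (TP * Ty - Tz * TP') * TQ' := by noncomm_ring
  have hTP : ‖TP‖ ≤ 1 := norm_transport_le_one' N M μ hV P
  have hTQ' : ‖TQ'‖ ≤ 1 := norm_transport_le_one' N M μ hV _
  have h1 : ‖TP * (TQ * Tx - Ty * TQ')‖ ≤ ‖TQ * Tx - Ty * TQ'‖ := by
    refine (Matrix.l2_opNorm_mul _ _).trans ?_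
    have h0 := norm_nonneg (TQ * Tx - Ty * TQ')
    nlinarith
  have h2 : ‖(TP * Ty - Tz * TP') * TQ'‖ ≤ ‖TP * Ty - Tz * TP'‖ := by
    refine (Matrix.l2_opNorm_mul _ _).trans ?_
    have h0 := norm_nonneg (TP * Ty - Tz * TP')
    nlinarith
  rw [e]
  exact (norm_add_le _ _).trans (by linarith)

omit [NeZero N] hM in
/-- **THE `1 × s` RECTANGLE** (Prop. 1's ladder, one rung at a time): for contractive data with the plaquette letter `p` in the `(ν, μ)`-planes,
`‖V_ν(v)·T(ℓ^s_{v+e_ν}) − T(ℓ^s_v)·V_ν(v + s e_μ)‖ ≤ s·p`. [cite: Balaban1985Averaging, p.24–25 (|V_{0,b} − 1| < |b₋ − y|α₀, shape)] [folklore] -/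
theorem rect_le [Nonempty m] (hV : ∀ ν b, ‖V ν b‖ ≤ 1) {p : ℝ} (hp0 : 0 ≤ p)
    (hp : ∀ (x : Tor (fine N M)) (ν : Fin d),
      ‖V ν (x, μ) * V μ (x + unitVec (fine N M) ν, μ) - V μ (x, μ) * V ν (x + unitVec (fine N M) μ, μ)‖ ≤ p)
    (v : Tor (fine N M)) (ν : Fin d) : ∀ s : ℕ,
    ‖V ν (v, μ) * transport (fine N M) V μ (leg N M μ (v + unitVec (fine N M) ν) s)
      - transport (fine N M) V μ (leg N M μ v s) * V ν (v + tstep (fine N M) μ s, μ)‖ ≤ s * p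
  | 0 => by
    rw [leg_zero, leg_zero, transport_nil, tstep_zero, add_zero, Matrix.mul_one, Matrix.one_mul, sub_self, norm_zero, Nat.cast_zero, zero_mul]
  | s + 1 => by
    have ih := rect_le hV hp0 hp v ν s
    rw [leg_succ, leg_succ, transport_append, transport_append, transport_singleton, transport_singleton]
    set T₁ := transport (fine N M) V μ (leg N M μ (v + unitVec (fine N M) ν) s)
    set T₂ := transport (fine N M) V μ (leg N M μ v s)
    set w := v + tstep (fine N M) μ s with hw
    have e1 : v + unitVec (fine N M) ν + tstep (fine N M) μ s = w + unitVec (fine N M) ν := by rw [hw, add_right_comm]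
    have e2 : v + tstep (fine N M) μ (s + 1) = w + unitVec (fine N M) μ := by rw [hw, tstep_succ, add_assoc]
    simp only [e1, e2]
    have e : V ν (v, μ) * (T₁ * V μ (w + unitVec (fine N M) ν, μ)) - T₂ * V μ (w, μ) * V ν (w + unitVec (fine N M) μ, μ)
        = (V ν (v, μ) * T₁ - T₂ * V ν (w, μ)) * V μ (w + unitVec (fine N M) ν, μ)
          + T₂ * (V ν (w, μ) * V μ (w + unitVec (fine N M) ν, μ) - V μ (w, μ) * V ν (w + unitVec (fine N M) μ, μ)) := by
      noncomm_ring
    rw [e]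
    refine (norm_add_le _ _).trans ?_
    have h1 : ‖(V ν (v, μ) * T₁ - T₂ * V ν (w, μ)) * V μ (w + unitVec (fine N M) ν, μ)‖ ≤ s * p := by
      refine (Matrix.l2_opNorm_mul _ _).trans ?_
      calc _ ≤ (s * p) * 1 := mul_le_mul ih (hV _ _) (norm_nonneg _) (mul_nonneg (Nat.cast_nonneg _) hp0)
        _ = s * p := mul_one _
    have h2 : ‖T₂ * (V ν (w, μ) * V μ (w + unitVec (fine N M) ν, μ) - V μ (w, μ) * V ν (w + unitVec (fine N M) μ, μ))‖ ≤ p := by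
      refine (Matrix.l2_opNorm_mul _ _).trans ?_
      calc _ ≤ 1 * p := mul_le_mul (norm_transport_le_one' N M μ hV _) (hp w ν) (norm_nonneg _) zero_le_one
        _ = p := one_mul _
    push_cast
    linarith

omit [NeZero N] hM in
/-- one bond swept: `lad ([(v,ν)]; v, v + e_ν) ≤ ℓ·p`. [folklore] -/
theorem lad_single_le [Nonempty m] (hV : ∀ ν b, ‖V ν b‖ ≤ 1) {p : ℝ} (hp0 : 0 ≤ p)
    (hp : ∀ (x : Tor (fine N M)) (ν : Fin d),
      ‖V ν (x, μ) * V μ (x + unitVec (fine N M) ν, μ) - V μ (x, μ) * V ν (x + unitVec (fine N M) μ, μ)‖ ≤ p)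
    (v : Tor (fine N M)) (ν : Fin d) : lad N M V μ ℓ [(v, ν)] v (v + unitVec (fine N M) ν) ≤ ℓ * p := by
  rw [lad, shiftBonds, List.map_cons, List.map_nil, transport_singleton, transport_singleton]
  exact rect_le N M μ hV hp0 hp v ν ℓ

omit [NeZero N] hM in
/-- a leg of `s` bonds swept: `lad (leg_ν(v, s); v, v + s e_ν) ≤ s·ℓ·p`. [folklore] -/
theorem lad_leg_le [Nonempty m] (hV : ∀ ν b, ‖V ν b‖ ≤ 1) {p : ℝ} (hp0 : 0 ≤ p)
    (hp : ∀ (x : Tor (fine N M)) (ν : Fin d),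
      ‖V ν (x, μ) * V μ (x + unitVec (fine N M) ν, μ) - V μ (x, μ) * V ν (x + unitVec (fine N M) μ, μ)‖ ≤ p)
    (v : Tor (fine N M)) (ν : Fin d) : ∀ s : ℕ, lad N M V μ ℓ (leg N M ν v s) v (v + tstep (fine N M) ν s) ≤ s * ℓ * p
  | 0 => by rw [leg_zero, tstep_zero, add_zero, lad_nil, Nat.cast_zero, zero_mul, zero_mul]
  | s + 1 => by
    rw [leg_succ, tstep_succ, ← add_assoc]
    refine (lad_append_le N M μ ℓ hV _ _ v (v + tstep (fine N M) ν s) _).trans ?_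
    have h1 := lad_leg_le hV hp0 hp v ν s
    have h2 := lad_single_le N M μ ℓ hV hp0 hp (v + tstep (fine N M) ν s) ν
    push_cast
    linarith

/-! ### The comb of `contourFrom` -/

variable (V)

/-- the digits below axis `ν`, as a torus vector (the start of the `ν`-th leg of the comb). [folklore] -/
def axesPrefix (r : Fin d → ℕ) (ν : Fin d) : Tor (fine N M) := fun κ => if κ < ν then ((r κ : ℕ) : ZMod (fine N M κ)) else 0

/-- all digits, as a torus vector (`x − z`). [folklore] -/
def rvec (r : Fin d → ℕ) : Tor (fine N M) := fun κ => ((r κ : ℕ) : ZMod (fine N M κ))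

/-- the digits below the `i`-th axis (natural-number index, for the induction over the axes). [folklore] -/
def natPrefix (r : Fin d → ℕ) (i : ℕ) : Tor (fine N M) := fun κ => if (κ : ℕ) < i then ((r κ : ℕ) : ZMod (fine N M κ)) else 0

/-- **THE COMB** `Γ_{z, z+r}` of `CovariantTableBalaban.contourFrom` (legs along the axes `0, …, d−1`). [folklore] -/
def comb (z : Tor (fine N M)) (r : Fin d → ℕ) : List (Tor (fine N M) × Fin d) :=
  (List.finRange d).flatMap fun ν => leg N M ν (z + axesPrefix N M r ν) (r ν)

/-- the first `i` legs of the comb. [folklore] -/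
def combTake (z : Tor (fine N M)) (r : Fin d → ℕ) (i : ℕ) : List (Tor (fine N M) × Fin d) :=
  ((List.finRange d).take i).flatMap fun ν => leg N M ν (z + axesPrefix N M r ν) (r ν)

/-- the partial comb lengths `Σ_{κ < i} r_κ`. [folklore] -/
def psum (r : Fin d → ℕ) (i : ℕ) : ℝ := ∑ κ : Fin d, if (κ : ℕ) < i then (r κ : ℝ) else 0

omit hM in
/-- `contourFrom z r μ s` IS the comb followed by the line of `s` bonds from `x = z + r`. [folklore] -/
theorem contourFrom_eq (z : Tor (fine N M)) (r : Fin d → ℕ) (s : ℕ) :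
    contourFrom M N z r μ s = comb N M z r ++ leg N M μ (z + rvec N M r) s := rfl

omit [NeZero N] hM in
/-- `natPrefix r i = axesPrefix r ⟨i, _⟩`. [folklore] -/
theorem natPrefix_eq_axesPrefix (r : Fin d → ℕ) {i : ℕ} (hi : i < d) : natPrefix N M r i = axesPrefix N M r ⟨i, hi⟩ := by
  funext κ
  simp only [natPrefix, axesPrefix, Fin.lt_def]

omit [NeZero N] hM in
/-- one more axis: `natPrefix r (i+1) = natPrefix r i + r_i e_i`. [folklore] -/
theorem natPrefix_succ (r : Fin d → ℕ) {i : ℕ} (hi : i < d) :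
    natPrefix N M r (i + 1) = natPrefix N M r i + tstep (fine N M) ⟨i, hi⟩ (r ⟨i, hi⟩) := by
  funext κ
  simp only [natPrefix, tstep, Pi.add_apply]
  by_cases h1 : (κ : ℕ) < i
  · have h2 : κ ≠ ⟨i, hi⟩ := fun h => by rw [h] at h1; exact lt_irrefl _ h1
    rw [if_pos (Nat.lt_succ_of_lt h1), if_pos h1, if_neg h2, add_zero]
  · by_cases h3 : (κ : ℕ) = i
    · have h4 : κ = ⟨i, hi⟩ := Fin.ext h3
      subst h4
      rw [if_pos (Nat.lt_succ_self _), if_neg h1, if_pos rfl, zero_add]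
    · have h5 : ¬ (κ : ℕ) < i + 1 := by omega
      have h6 : κ ≠ ⟨i, hi⟩ := fun h => h3 (by rw [h])
      rw [if_neg h5, if_neg h1, if_neg h6, add_zero]

omit [NeZero N] hM in
/-- all axes: `natPrefix r d = rvec r`. [folklore] -/
theorem natPrefix_d (r : Fin d → ℕ) : natPrefix N M r d = rvec N M r := by
  funext κ
  simp only [natPrefix, rvec, if_pos κ.2]

omit [NeZero N] hM in
/-- no axes: `natPrefix r 0 = 0`. [folklore] -/
theorem natPrefix_zero (r : Fin d → ℕ) : natPrefix N M r 0 = 0 := by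
  funext κ
  simp only [natPrefix, Nat.not_lt_zero, if_false, Pi.zero_apply]

/-- one more axis in the partial length: `psum r (i+1) = psum r i + r_i`. [folklore] -/
theorem psum_succ (r : Fin d → ℕ) {i : ℕ} (hi : i < d) : psum r (i + 1) = psum r i + r ⟨i, hi⟩ := by
  have h : ∀ κ : Fin d, (if (κ : ℕ) < i + 1 then (r κ : ℝ) else 0) = (if (κ : ℕ) < i then (r κ : ℝ) else 0) + (if κ = ⟨i, hi⟩ then (r κ : ℝ) else 0) := by
    intro κ
    by_cases h1 : (κ : ℕ) < i
    · have h2 : κ ≠ ⟨i, hi⟩ := fun h => by rw [h] at h1; exact lt_irrefl _ h1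
      rw [if_pos (Nat.lt_succ_of_lt h1), if_pos h1, if_neg h2, add_zero]
    · by_cases h3 : κ = ⟨i, hi⟩
      · subst h3
        rw [if_pos (Nat.lt_succ_self _), if_neg h1, if_pos rfl, zero_add]
      · have h4 : (κ : ℕ) ≠ i := fun h => h3 (Fin.ext h)
        have h5 : ¬ (κ : ℕ) < i + 1 := by omega
        rw [if_neg h5, if_neg h1, if_neg h3, add_zero]
  rw [psum, psum, Finset.sum_congr rfl fun κ _ => h κ, Finset.sum_add_distrib]
  simp only [Finset.sum_ite_eq', Finset.mem_univ, if_true]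

/-- `psum r 0 = 0`. [folklore] -/
theorem psum_zero (r : Fin d → ℕ) : psum r 0 = 0 := by
  simp [psum]

/-- `psum r d = Σ_ν r_ν`. [folklore] -/
theorem psum_d (r : Fin d → ℕ) : psum r d = ∑ ν, (r ν : ℝ) :=
  Finset.sum_congr rfl fun κ _ => if_pos κ.2

/-- `0 ≤ psum`. [folklore] -/
theorem psum_nonneg (r : Fin d → ℕ) (i : ℕ) : 0 ≤ psum r i :=
  Finset.sum_nonneg fun κ _ => by split_ifs <;> positivity

omit [NeZero N] hM in
/-- `combTake 0 = []`. [folklore] -/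
theorem combTake_zero (z : Tor (fine N M)) (r : Fin d → ℕ) : combTake N M z r 0 = [] := by
  rw [combTake, List.take_zero, List.flatMap_nil]

omit [NeZero N] hM in
/-- one more leg: `combTake (i+1) = combTake i ++ leg_i`. [folklore] -/
theorem combTake_succ (z : Tor (fine N M)) (r : Fin d → ℕ) {i : ℕ} (hi : i < d) :
    combTake N M z r (i + 1) = combTake N M z r i ++ leg N M ⟨i, hi⟩ (z + axesPrefix N M r ⟨i, hi⟩) (r ⟨i, hi⟩) := by
  have hlen : i < (List.finRange d).length := by rwa [List.length_finRange]
  have hget : (List.finRange d)[i]? = some ⟨i, hi⟩ := by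
    rw [List.getElem?_eq_getElem hlen, List.getElem_finRange]; rfl
  rw [combTake, combTake, List.take_add_one, hget, Option.toList_some, List.flatMap_append, List.flatMap_singleton]

omit [NeZero N] hM in
/-- all legs: `combTake d = comb`. [folklore] -/
theorem combTake_d (z : Tor (fine N M)) (r : Fin d → ℕ) : combTake N M z r d = comb N M z r := by
  rw [combTake, comb, List.take_of_length_le (by rw [List.length_finRange])]

omit [NeZero N] hM in
/-- the translate of the comb is the comb from the translated corner (print: `Γ_{c₊,x′} = Γ_{c₋,x} + L e_μ`). [folklore] -/
theorem shiftBonds_comb (z : Tor (fine N M)) (r : Fin d → ℕ) : shiftBonds N M μ ℓ (comb N M z r) = comb N M (z + tstep (fine N M) μ ℓ) r := by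
  unfold comb shiftBonds
  rw [List.map_flatMap]
  congr 1
  funext ν
  have h := shiftBonds_leg N M μ ℓ ν (z + axesPrefix N M r ν) (r ν)
  rw [shiftBonds] at h
  rw [h, add_right_comm]

variable {V}

omit [NeZero N] hM in
/-- the first `i` legs swept: `lad (combTake i; z, z + natPrefix r i) ≤ (Σ_{κ<i} r_κ)·ℓ·p`. [folklore] -/
theorem lad_combTake_le [Nonempty m] (hV : ∀ ν b, ‖V ν b‖ ≤ 1) {p : ℝ} (hp0 : 0 ≤ p)
    (hp : ∀ (x : Tor (fine N M)) (ν : Fin d),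
      ‖V ν (x, μ) * V μ (x + unitVec (fine N M) ν, μ) - V μ (x, μ) * V ν (x + unitVec (fine N M) μ, μ)‖ ≤ p)
    (z : Tor (fine N M)) (r : Fin d → ℕ) : ∀ i : ℕ, i ≤ d → lad N M V μ ℓ (combTake N M z r i) z (z + natPrefix N M r i) ≤ psum r i * ℓ * p
  | 0, _ => by rw [combTake_zero, natPrefix_zero, add_zero, lad_nil, psum_zero, zero_mul, zero_mul]
  | i + 1, hi1 => by
    have hi : i < d := Nat.lt_of_succ_le hi1
    have ih := lad_combTake_le hV hp0 hp z r i hi.le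
    rw [combTake_succ N M z r hi, natPrefix_succ N M r hi, ← add_assoc, psum_succ r hi, ← natPrefix_eq_axesPrefix N M r hi]
    refine (lad_append_le N M μ ℓ hV _ _ z (z + natPrefix N M r i) _).trans ?_
    have h2 := lad_leg_le N M μ ℓ hV hp0 hp (z + natPrefix N M r i) ⟨i, hi⟩ (r ⟨i, hi⟩)
    linarith

omit [NeZero N] hM in
/-- **THE COMB SWEPT** (Prop. 1's Stokes ladder for the thin loop of (114)): `‖T(Γ_{z,x})·T(ℓ_x) − T(ℓ_z)·T(Γ_{z⁺,x⁺})‖ ≤ (Σ_ν r_ν)·ℓ·p`, `x = z + r`. [folklore] -/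
theorem lad_comb_le [Nonempty m] (hV : ∀ ν b, ‖V ν b‖ ≤ 1) {p : ℝ} (hp0 : 0 ≤ p)
    (hp : ∀ (x : Tor (fine N M)) (ν : Fin d),
      ‖V ν (x, μ) * V μ (x + unitVec (fine N M) ν, μ) - V μ (x, μ) * V ν (x + unitVec (fine N M) μ, μ)‖ ≤ p)
    (z : Tor (fine N M)) (r : Fin d → ℕ) : lad N M V μ ℓ (comb N M z r) z (z + rvec N M r) ≤ (∑ ν, (r ν : ℝ)) * ℓ * p := by
  have h := lad_combTake_le N M μ ℓ hV hp0 hp z r d le_rfl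
  rwa [combTake_d, natPrefix_d, psum_d] at h

end Ladder

end Summit.QuantumFields.BalabanUV.T4Continuum.NE2.OneStepLoopLadder

end
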